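import Mathlib
import HarnessLib
import Literature.Computability.AlgebraicComplexity.SymmetricArithCircuit
import Literature.Computability.AlgebraicComplexity.DawarWilsenach2025
import Literature.Computability.AlgebraicComplexity.CircuitDepth
import Literature.Computability.AlgebraicComplexity.ValiantConjectureProofs

/-!
# Route MonotoneRestoration — crux `OrbitRestorationQP` (stmt-ValiantsHypothesis-18293): vocabulary of
# the line `depth-three-rung` (route-posited objects, D-0016 `<RouteSlug>Defs.lean`)

The registered skeleton `Cruxes/OrbitRestorationQP/Lines/depth_three_rung.lean` (fwd-ladder G4, the
product-depth ladder under the crux `X = OrbitRestorationQP`) phrases its four stubs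
(`stub_equivariantTerms`, `stub_circuitOfEquivariantTerms`, `stub_logDepthRestoration`, `stub_vsbr`)
in a small local vocabulary.  The stub files `Theorems/MonotoneRestorationOrbitRestorationQP*.lean`
that land these stubs by name must speak about THE SAME declarations, so the vocabulary is collected
here, VERBATIM from the skeleton (same names, same bodies; namespace
`Summit.ValiantsHypothesis.ValiantsHypothesis.Theorems.OrbitRestorationQPDepthThreeRung`).  Nothing
here asserts anything; no instance, no notation.

* `IsMatrixSymmetric f` — invariance of a family on the `n × n` matrix under independent row and
  column permutations (the hypothesis of `OrbitRestorationQP`);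
* `QPOrbitRestorable c n p` — `p` has a square-symmetric labelled circuit over `ℂ` of ORBIT size
  `≤ 2^((log₂ n + c)^c)` (the conclusion of `OrbitRestorationQP` at one level);
* `RestorationOn 𝒞` — the graded family "every matrix-symmetric family in the class `𝒞 n c` is
  quasi-polynomially orbit-restorable"; `VPClass`, `PDClass δ` (product-depth slices, tree
  `ArithCircuit.productDepth` / `edgeSize`), `SparseClass`; the rungs `ProductDepthRestorationQP δ`
  (the skeleton's parameterless abbreviations `SigmaPiSigmaRestorationQP := ProductDepthRestorationQP 1`
  and `LogDepthRestorationQP` are conjecture-grade statements and are deliberately NOT declared here);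
* `IsEquivariantTerms n c T` — an `Sym_n`-stable multiset of quasi-polynomially many products of
  quasi-polynomially many affine forms (the interface between stubs A and B).

References: Dawar–Wilsenach 2025 §3.3 (`ORB`); Limaye–Srinivasan–Tavenas 2021 (product depth);
Bürgisser 2000 Def. 2.4 (p-bounded families).
-/

noncomputable section

-- `Summit.ValiantsHypothesis.ValiantsHypothesis.…` is the tree's single-conjunct layout (Sub = Summit).
set_option linter.dupNamespace false

namespace Summit.ValiantsHypothesis.ValiantsHypothesis.Theorems.OrbitRestorationQPDepthThreeRung

open Literature.Computability.AlgebraicComplexity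

/-- Matrix symmetry of a family on the `n × n` variable matrix: invariance under INDEPENDENT row and
column permutations (verbatim the hypothesis of `OrbitRestorationQP`). [folklore] -/
def IsMatrixSymmetric (f : (n : ℕ) → MvPolynomial (Fin n × Fin n) ℂ) : Prop :=
  ∀ (n : ℕ) (σ τ : Equiv.Perm (Fin n)),
    MvPolynomial.rename (fun p : Fin n × Fin n => (σ p.1, τ p.2)) (f n) = f n

/-- Quasi-polynomial ORBIT restorability of one polynomial at level `n` with constant `c`: a
square-symmetric labelled circuit over `ℂ` (diagonal action of `Sym (Fin n)`) computing `p` all of whose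
gate orbits have size `≤ 2^((log₂ n + c)^c)` (verbatim the conclusion of `OrbitRestorationQP`).
[cite: DawarWilsenach2025, §3.3 (ORB)] -/
def QPOrbitRestorable (c n : ℕ) (p : MvPolynomial (Fin n × Fin n) ℂ) : Prop :=
  ∃ (G : Type) (_ : Fintype G) (C : LabelledArithCircuit ℂ (Fin n × Fin n) Unit G),
    C.IsSymmetric (Equiv.Perm (Fin n)) ∧ C.eval (C.output ()) = p ∧
      C.orbitSize (Equiv.Perm (Fin n)) ≤ 2 ^ ((Nat.log 2 n + c) ^ c)

/-- **The graded family.** `RestorationOn 𝒞`: every matrix-symmetric family whose `n`-th member lies in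
the class `𝒞 n c` for one constant `c` and all `n` is quasi-polynomially orbit-restorable. [folklore] -/
def RestorationOn (𝒞 : (n : ℕ) → ℕ → MvPolynomial (Fin n × Fin n) ℂ → Prop) : Prop :=
  ∀ f : (n : ℕ) → MvPolynomial (Fin n × Fin n) ℂ, IsMatrixSymmetric f →
    (∃ c : ℕ, ∀ n : ℕ, 𝒞 n c (f n)) → ∃ c : ℕ, ∀ n : ℕ, QPOrbitRestorable c n (f n)

/-- The class `VP` sliced at level `n` with constant `c`: total degree and fan-in-two complexity
`≤ n^c + c`. [cite: Burgisser2000, Def. 2.4] -/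
def VPClass (n c : ℕ) (q : MvPolynomial (Fin n × Fin n) ℂ) : Prop :=
  q.totalDegree ≤ n ^ c + c ∧ complexity q ≤ n ^ c + c

/-- The product-depth-`δ` slice of `VP`: degree and complexity `≤ n^c + c` and an unbounded-fan-in
circuit (tree `ArithCircuit`) computing `q` with product-depth `≤ δ n` (tree
`ArithCircuit.productDepth`) and at most `n^c + c` wires (`ArithCircuit.edgeSize`).
[cite: LimayeSrinivasanTavenas2021, §1–2] -/
def PDClass (δ : ℕ → ℕ) (n c : ℕ) (q : MvPolynomial (Fin n × Fin n) ℂ) : Prop :=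
  q.totalDegree ≤ n ^ c + c ∧ complexity q ≤ n ^ c + c ∧
    ∃ P : ArithCircuit ℂ (Fin n × Fin n), P.Computes q ∧ P.productDepth ≤ δ n ∧ P.edgeSize ≤ n ^ c + c

/-- The sparse slice: at most `n^c + c` monomials and total degree `≤ n^c + c`. [folklore] -/
def SparseClass (n c : ℕ) (q : MvPolynomial (Fin n × Fin n) ℂ) : Prop :=
  q.support.card ≤ n ^ c + c ∧ q.totalDegree ≤ n ^ c + c

/-- Rung `δ` of the product-depth ladder. [folklore] -/
def ProductDepthRestorationQP (δ : ℕ → ℕ) : Prop := RestorationOn (PDClass δ)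

/-- An `Sym_n`-STABLE multiset of product terms of affine forms of quasi-polynomial size at level `n`
with constant `c`: every factor has total degree `≤ 1`, at most `2^((log₂ n + c)^c)` terms, each with at
most that many factors, and the diagonal action of every `σ ∈ Sym (Fin n)` maps the multiset of terms to
itself. [folklore] -/
def IsEquivariantTerms (n c : ℕ) (T : Multiset (Multiset (MvPolynomial (Fin n × Fin n) ℂ))) : Prop :=
  (∀ m ∈ T, ∀ ℓ ∈ m, ℓ.totalDegree ≤ 1) ∧ Multiset.card T ≤ 2 ^ ((Nat.log 2 n + c) ^ c) ∧
    (∀ m ∈ T, Multiset.card m ≤ 2 ^ ((Nat.log 2 n + c) ^ c)) ∧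
      ∀ σ : Equiv.Perm (Fin n),
        T.map (Multiset.map fun ℓ => MvPolynomial.rename (fun pq : Fin n × Fin n => σ • pq) ℓ) = T

end Summit.ValiantsHypothesis.ValiantsHypothesis.Theorems.OrbitRestorationQPDepthThreeRung

end
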